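import Summits.Ventures.QEC.Census.FoldDefs2
import HarnessLib

/-!
# Fold enumeration — linear-map and bit-count lemmas (`lin`, `xorIdx`, `bitsOf`, `popc`)

Cell `qec`, PARTITION row type-11 ("kernel C"), soundness layer 1 of `Census/FoldDefs.lean`: the
structural linear map `lin g n i0 u = ⊕_{k<n, bit k of u} g (i0+k)` is additive (`lin_xor`), is
determined by its values on basis words (`lin_two_pow`, used to transport finitely-checked identities
to all words: `lin_eq_lin_of_basis`), agrees with the list evaluator `xorIdx` (`xorIdx_eq_lin`); bits of
`lin` with power values (`testBit_lin_pow_iff`); `bitsOf` lists the support (`maskOf_bitsOf`,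
`lt_of_mem_bitsOf`, `length_bitsOf`); and the bit-count identities `popc (a ⊕ b) + 2·popc (a ∧ b) =
popc a + popc b`, `popc` under an injective placement (`popc_lin_pow_inj`).  Folklore; structural
inductions on the bit width.
-/

namespace Summit.Ventures.QEC.Census.Fold

open Summit.Ventures.QEC.Census Finset

/-! ## `xorIdx` -/

/-- `xorIdx_nil`: xorIdx nil (auxiliary lemma of the fold-certificate soundness chain). -/
@[simp] theorem xorIdx_nil {α : Type} (g : α → ℕ) : xorIdx g [] = 0 := rfl

/-- `xorIdx_cons`: xorIdx cons (auxiliary lemma of the fold-certificate soundness chain). -/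
@[simp] theorem xorIdx_cons {α : Type} (g : α → ℕ) (x : α) (L : List α) :
    xorIdx g (x :: L) = g x ^^^ xorIdx g L := rfl

/-- `xorIdx_append`: xorIdx append (auxiliary lemma of the fold-certificate soundness chain). -/
theorem xorIdx_append {α : Type} (g : α → ℕ) (L M : List α) :
    xorIdx g (L ++ M) = xorIdx g L ^^^ xorIdx g M := by
  induction L with
  | nil => simp
  | cons x L ih => rw [List.cons_append, xorIdx_cons, xorIdx_cons, ih, Nat.xor_assoc]

/-- `xorIdx_map`: xorIdx map (auxiliary lemma of the fold-certificate soundness chain). -/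
theorem xorIdx_map {α β : Type} (g : β → ℕ) (f : α → β) (L : List α) :
    xorIdx g (L.map f) = xorIdx (g ∘ f) L := by
  induction L with
  | nil => rfl
  | cons x L ih => simp [ih]

/-- Pointwise-xor of value functions passes through `xorIdx`. -/
theorem xorIdx_xor_fun {α : Type} (g h : α → ℕ) (L : List α) :
    xorIdx (fun x => g x ^^^ h x) L = xorIdx g L ^^^ xorIdx h L := by
  induction L with
  | nil => simp
  | cons x L ih =>
    simp only [xorIdx_cons, ih]
    rw [Nat.xor_assoc, Nat.xor_assoc, ← Nat.xor_assoc (h x), Nat.xor_comm (h x) (xorIdx g L),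
      Nat.xor_assoc]

/-- `xorIdx_congr`: xorIdx congr (auxiliary lemma of the fold-certificate soundness chain). -/
theorem xorIdx_congr {α : Type} {g h : α → ℕ} {L : List α} (hL : ∀ x ∈ L, g x = h x) :
    xorIdx g L = xorIdx h L := by
  induction L with
  | nil => rfl
  | cons x L ih =>
    rw [xorIdx_cons, xorIdx_cons, hL x (by simp), ih fun y hy => hL y (by simp [hy])]

/-- `xorIdx_const_zero`: xorIdx const zero (auxiliary lemma of the fold-certificate soundness chain). -/
@[simp] theorem xorIdx_const_zero {α : Type} (L : List α) : xorIdx (fun _ => 0) L = 0 := by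
  induction L with
  | nil => rfl
  | cons x L ih => simp [ih]

/-! ## parity / halving of bitwise operations -/

/-- `xor_mod_two`: xor mod two (auxiliary lemma of the fold-certificate soundness chain). -/
theorem xor_mod_two (a b : ℕ) : (a ^^^ b) % 2 = (a % 2 + b % 2) % 2 := by
  have h := Nat.xor_mod_two_pow (a := a) (b := b) (n := 1)
  simp only [Nat.pow_one] at h
  rw [h]
  rcases Nat.mod_two_eq_zero_or_one a with ha | ha <;> rcases Nat.mod_two_eq_zero_or_one b with hb | hb <;>
    simp [ha, hb]

/-- `xor_div_two`: xor div two (auxiliary lemma of the fold-certificate soundness chain). -/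
theorem xor_div_two (a b : ℕ) : (a ^^^ b) / 2 = a / 2 ^^^ b / 2 := by
  apply Nat.eq_of_testBit_eq
  intro i
  rw [Nat.testBit_div_two, Nat.testBit_xor, Nat.testBit_xor, Nat.testBit_div_two, Nat.testBit_div_two]

/-- low bit and upper bits of an `and` (both halving rules at once). -/
theorem and_mod_two_div_two (a b : ℕ) : (a &&& b) % 2 = a % 2 * (b % 2) ∧ (a &&& b) / 2 = a / 2 &&& b / 2 := by
  refine ⟨?_, ?_⟩
  · have h := Nat.and_mod_two_pow (a := a) (b := b) (n := 1)
    simp only [Nat.pow_one] at h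
    rw [h]
    rcases Nat.mod_two_eq_zero_or_one a with ha | ha <;> rcases Nat.mod_two_eq_zero_or_one b with hb | hb <;>
      simp [ha, hb]
  · apply Nat.eq_of_testBit_eq
    intro i
    rw [Nat.testBit_div_two, Nat.testBit_and, Nat.testBit_and, Nat.testBit_div_two, Nat.testBit_div_two]

/-- halving rules of `2^(j+1)` (low bit and upper bits at once). -/
theorem two_pow_succ_mod_two_div_two (j : ℕ) : 2 ^ (j + 1) % 2 = 0 ∧ 2 ^ (j + 1) / 2 = 2 ^ j := by
  rw [Nat.pow_succ]; omega

/-! ## `lin` -/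

/-- `lin_zero_width`: lin zero width (auxiliary lemma of the fold-certificate soundness chain). -/
@[simp] theorem lin_zero_width (g : ℕ → ℕ) (i0 u : ℕ) : lin g 0 i0 u = 0 := rfl

/-- `lin_succ`: lin succ (auxiliary lemma of the fold-certificate soundness chain). -/
theorem lin_succ (g : ℕ → ℕ) (n i0 u : ℕ) :
    lin g (n + 1) i0 u = (if u % 2 = 1 then g i0 else 0) ^^^ lin g n (i0 + 1) (u / 2) := rfl

/-- `lin_zero`: lin zero (auxiliary lemma of the fold-certificate soundness chain). -/
@[simp] theorem lin_zero (g : ℕ → ℕ) (n i0 : ℕ) : lin g n i0 0 = 0 := by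
  induction n generalizing i0 with
  | zero => rfl
  | succ n ih => simp [lin_succ, ih]

/-- ADDITIVITY: `lin g n i0 (u ⊕ v) = lin g n i0 u ⊕ lin g n i0 v`. -/
theorem lin_xor (g : ℕ → ℕ) (n i0 u v : ℕ) : lin g n i0 (u ^^^ v) = lin g n i0 u ^^^ lin g n i0 v := by
  induction n generalizing i0 u v with
  | zero => simp
  | succ n ih =>
    simp only [lin_succ, xor_mod_two, xor_div_two, ih]
    rcases Nat.mod_two_eq_zero_or_one u with hu | hu <;> rcases Nat.mod_two_eq_zero_or_one v with hv | hv <;>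
      simp [hu, hv, Nat.xor_assoc, Nat.xor_left_comm]

/-- `lin` over a `xorIdx`. -/
theorem lin_xorIdx {α : Type} (g : ℕ → ℕ) (n i0 : ℕ) (h : α → ℕ) (L : List α) :
    lin g n i0 (xorIdx h L) = xorIdx (fun x => lin g n i0 (h x)) L := by
  induction L with
  | nil => simp
  | cons x L ih => rw [xorIdx_cons, lin_xor, ih, xorIdx_cons]

/-- `lin` only reads the low `n` bits. -/
theorem lin_mod (g : ℕ → ℕ) (n i0 u : ℕ) : lin g n i0 (u % 2 ^ n) = lin g n i0 u := by
  induction n generalizing i0 u with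
  | zero => rfl
  | succ n ih =>
    rw [lin_succ, lin_succ]
    have h1 : u % 2 ^ (n + 1) % 2 = u % 2 := by
      rw [Nat.pow_succ', Nat.mod_mul]; omega
    have h2 : u % 2 ^ (n + 1) / 2 = u / 2 % 2 ^ n := by
      rw [Nat.pow_succ', Nat.mod_mul_right_div_self]
    rw [h1, h2, ih]

/-- The value on a basis word inside the window. -/
theorem lin_two_pow (g : ℕ → ℕ) (n : ℕ) : ∀ (i0 j : ℕ), j < n → lin g n i0 (2 ^ j) = g (i0 + j) := by
  induction n with
  | zero => intro i0 j hj; omega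
  | succ n ih =>
    intro i0 j hj
    rw [lin_succ]
    cases j with
    | zero => simp [lin_zero]
    | succ j =>
      rw [(two_pow_succ_mod_two_div_two j).1, (two_pow_succ_mod_two_div_two j).2, ih (i0 + 1) j (by omega)]
      simp [Nat.add_assoc, Nat.add_comm 1 j]

/-- A basis word outside the window contributes nothing. -/
theorem lin_two_pow_of_le (g : ℕ → ℕ) (n : ℕ) : ∀ (i0 j : ℕ), n ≤ j → lin g n i0 (2 ^ j) = 0 := by
  induction n with
  | zero => intro i0 j _; rfl
  | succ n ih =>
    intro i0 j hj
    rw [lin_succ]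
    cases j with
    | zero => omega
    | succ j =>
      rw [(two_pow_succ_mod_two_div_two j).1, (two_pow_succ_mod_two_div_two j).2, ih (i0 + 1) j (by omega)]
      simp

/-- Two coefficient functions agreeing on the window give the same map. -/
theorem lin_congr {g h : ℕ → ℕ} {n i0 : ℕ} (hgh : ∀ k, k < n → g (i0 + k) = h (i0 + k)) (u : ℕ) :
    lin g n i0 u = lin h n i0 u := by
  induction n generalizing i0 u with
  | zero => rfl
  | succ n ih =>
    rw [lin_succ, lin_succ, ih (i0 := i0 + 1) (fun k hk => by
      have := hgh (k + 1) (by omega); rwa [show i0 + 1 + k = i0 + (k + 1) from by omega])]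
    have h0 := hgh 0 (by omega)
    simp only [Nat.add_zero] at h0
    rw [h0]

/-- BITS of `lin` with power values: bit `i` is set iff an odd number of window bits `k` of `u` have
`σ (i0+k) = i`; for `σ` injective on the window this is "some". -/
theorem testBit_lin_pow_iff (σ : ℕ → ℕ) (n : ℕ) :
    ∀ (i0 u i : ℕ), (∀ k₁ k₂, k₁ < n → k₂ < n → σ (i0 + k₁) = σ (i0 + k₂) → k₁ = k₂) →
      ((lin (fun k => 2 ^ σ k) n i0 u).testBit i = true ↔ ∃ k, k < n ∧ u.testBit k = true ∧ σ (i0 + k) = i) := by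
  induction n with
  | zero => intro i0 u i _; simp
  | succ n ih =>
    intro i0 u i hinj
    rw [lin_succ, Nat.testBit_xor]
    have ih' := ih (i0 + 1) (u / 2) i (fun k₁ k₂ h₁ h₂ he => by
      have := hinj (k₁ + 1) (k₂ + 1) (by omega) (by omega)
        (by rwa [Nat.add_assoc, Nat.add_comm 1, Nat.add_assoc, Nat.add_comm 1] at he
            |> fun x => by rw [← Nat.add_assoc, ← Nat.add_assoc]; exact x)
      omega)
    -- first summand bit
    have hA : ((if u % 2 = 1 then 2 ^ σ i0 else 0).testBit i = true) ↔ (u.testBit 0 = true ∧ σ i0 = i) := by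
      rw [Nat.testBit_zero]
      split
      · rename_i h; simp [Nat.testBit_two_pow, h]
      · rename_i h; simp [h]
    -- the two summands are never both set (injectivity)
    have hexcl : ¬ (((if u % 2 = 1 then 2 ^ σ i0 else 0).testBit i = true) ∧
        (lin (fun k => 2 ^ σ k) n (i0 + 1) (u / 2)).testBit i = true) := by
      rintro ⟨h1, h2⟩
      rw [hA] at h1
      rw [ih'] at h2
      obtain ⟨k, hk, -, hσ⟩ := h2
      have := hinj 0 (k + 1) (by omega) (by omega) (by
        rw [Nat.add_zero, h1.2, ← hσ, Nat.add_assoc, Nat.add_comm 1 k])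
      omega
    constructor
    · intro h
      -- xor true ⇒ one of them
      rcases hb : ((if u % 2 = 1 then 2 ^ σ i0 else 0).testBit i) with _ | _
      · rw [hb] at h
        simp only [Bool.false_xor] at h
        rw [ih'] at h
        obtain ⟨k, hk, hu, hσ⟩ := h
        refine ⟨k + 1, by omega, ?_, by rw [← hσ, Nat.add_assoc, Nat.add_comm 1 k]⟩
        rw [← Nat.testBit_div_two]; exact hu
      · have h1 := (hA).1 hb
        exact ⟨0, by omega, h1.1, by rw [Nat.add_zero]; exact h1.2⟩
    · rintro ⟨k, hk, hu, hσ⟩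
      cases k with
      | zero =>
        have h1 : ((if u % 2 = 1 then 2 ^ σ i0 else 0).testBit i = true) := hA.2 ⟨hu, by simpa using hσ⟩
        rcases hb : (lin (fun k => 2 ^ σ k) n (i0 + 1) (u / 2)).testBit i with _ | _
        · simp [h1]
        · exact absurd ⟨h1, hb⟩ hexcl
      | succ k =>
        have h2 : (lin (fun k => 2 ^ σ k) n (i0 + 1) (u / 2)).testBit i = true := by
          rw [ih']
          refine ⟨k, by omega, by rw [Nat.testBit_div_two]; exact hu, ?_⟩
          rw [← hσ, Nat.add_assoc, Nat.add_comm 1 k]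
        rcases hb : ((if u % 2 = 1 then 2 ^ σ i0 else 0).testBit i) with _ | _
        · simp [hb, h2]
        · exact absurd ⟨hb, h2⟩ hexcl

/-- `lin (2^·) n 0 u = u mod 2^n`: a word is the xor of its basis words. -/
theorem lin_pow_self (n u : ℕ) : lin (fun j => 2 ^ j) n 0 u = u % 2 ^ n := by
  apply Nat.eq_of_testBit_eq
  intro i
  rw [Nat.testBit_mod_two_pow]
  have key := testBit_lin_pow_iff (fun k => k) n 0 u i (fun _ _ _ _ h => by simpa using h)
  simp only [Nat.zero_add] at key
  rcases hb : (lin (fun j => 2 ^ j) n 0 u).testBit i with _ | _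
  · symm
    rw [Bool.eq_false_iff]
    intro h
    simp only [Bool.and_eq_true, decide_eq_true_eq] at h
    have : (lin (fun j => 2 ^ j) n 0 u).testBit i = true := key.2 ⟨i, h.1, h.2, rfl⟩
    rw [hb] at this; exact Bool.false_ne_true this
  · obtain ⟨k, hk, hu, rfl⟩ := key.1 hb
    simp [hk, hu]

/-- TRANSPORT OF BASIS IDENTITIES: two `lin` maps that agree on every basis word of the window agree on
every word. -/
theorem lin_eq_lin_of_basis {g h : ℕ → ℕ} {n : ℕ}
    (hb : ∀ j, j < n → lin g n 0 (2 ^ j) = lin h n 0 (2 ^ j)) (u : ℕ) : lin g n 0 u = lin h n 0 u := by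
  refine lin_congr (i0 := 0) (fun k hk => ?_) u
  have := hb k hk
  rwa [lin_two_pow g n 0 k hk, lin_two_pow h n 0 k hk] at this

/-- COMPOSITION through basis words: a `lin` map applied after another is the `lin` map of the images. -/
theorem lin_lin (g : ℕ → ℕ) (m : ℕ) (h : ℕ → ℕ) (n u : ℕ) :
    lin g m 0 (lin h n 0 u) = lin (fun k => lin g m 0 (h k)) n 0 u := by
  induction n generalizing u h with
  | zero => simp
  | succ n ih =>
    rw [lin_succ, lin_succ, lin_xor, Nat.zero_add]
    congr 1
    · split <;> simp
    · rw [lin_shift_aux, lin_shift_aux (fun k => lin g m 0 (h k)), ih]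
where
  /-- `lin f n 1 v = lin (f ∘ succ) n 0 v` -/
  lin_shift_aux (f : ℕ → ℕ) {n v : ℕ} : lin f n 1 v = lin (fun k => f (k + 1)) n 0 v := by
    have : ∀ (i0 : ℕ) (w : ℕ), lin f n (i0 + 1) w = lin (fun k => f (k + 1)) n i0 w := by
      induction n with
      | zero => intro i0 w; rfl
      | succ n ih2 => intro i0 w; rw [lin_succ, lin_succ, ih2]
    exact this 0 v

/-- The list evaluator is the linear map on the support mask (indices inside the window). -/
theorem xorIdx_eq_lin (g : ℕ → ℕ) (n : ℕ) (J : List ℕ) (hJ : ∀ j ∈ J, j < n) :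
    xorIdx g J = lin g n 0 (maskOf J) := by
  induction J with
  | nil => simp [maskOf]
  | cons j J ih =>
    rw [xorIdx_cons, maskOf, xorIdx_cons, lin_xor, lin_two_pow g n 0 j (hJ j (by simp)), Nat.zero_add,
      ← maskOf, ih fun x hx => hJ x (by simp [hx])]

end Summit.Ventures.QEC.Census.Fold
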